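import Summits.AnomalousDissipation.AnomalousDissipation.Theorems.MomentParityResolvedDissipationInvariance
import Literature.Analysis.FluidPDE.GalerkinFlow

/-!
# Stub `stub_pathwiseDissipation` for line `enstrophy-ui-transfer` (crux `MomentParity.ResolvedDissipation`, stmt-AnomalousDissipation-14284)

S2 of skeleton v3 (lead c4): the time-integrated enstrophy of a single Galerkin orbit of forced
3-D Navier–Stokes on `T³` is bounded UNIFORMLY in the Galerkin order `N`:
for `ν > 0`, a smooth force `f`, a Galerkin mode `a` of order `N` whose orbit
`S_t a = Torus.galerkinFlow ν f N t a` stays mean-zero, and `T ≥ 0`,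
`∫₀ᵀ ‖∇S_t a‖² dt ≤ (‖a‖₂² + T‖f‖₂²/(4π²ν))/ν`.

Proof (Robinson–Rodrigo–Sadowski 2016, Thm. 4.4 Step 2, (4.6)–(4.8)):
* the exact energy identity of the orbit (`IsGalerkinMode.galerkinFlow_clauses`, last clause, from
  `s = 0`): `½‖S_T a‖² + ν∫₀ᵀ‖∇S_t a‖² = ½‖a‖² + ∫₀ᵀ∫⟪f, S_t a⟫`;
* the lintegral is honest: in the coefficient picture (`IsGalerkinMode.galerkinFlow_eq`,
  `eGradNormSq_coeffExt`) the integrand `t ↦ 4π² ∑ₖ |k|²‖ĉₖ(t)‖²` is continuous on `[0, T]`;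
* spectral Poincaré–Young on the finite frequency set (`integral_inner_realTrigPoly_le`): the zero
  mode of the mean-zero state vanishes, `|k|² ≥ 1` elsewhere, Young termwise and Bessel give
  `∫⟪f, S_t a⟫ ≤ ‖f‖₂²/(8π²ν) + (ν/2)‖∇S_t a‖²`;
* integrate in time and absorb. `0 < ν` is load-bearing.
-/

noncomputable section

-- `Summit.<Summit>.<Problem>`: single-conjunct summit, the duplicate namespace segment is mandated.
set_option linter.dupNamespace false

namespace Summit.AnomalousDissipation.AnomalousDissipation.Theorems.MomentParityResolvedDissipation.PathwiseDissipation

open MeasureTheory Filter Topology Set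
open scoped ENNReal InnerProductSpace RealInnerProductSpace
open Literature.Analysis.FunctionSpaces Literature.Analysis.FluidPDE
open Summit.AnomalousDissipation.AnomalousDissipation.Theses.MomentParity
open Summit.AnomalousDissipation.AnomalousDissipation.Theorems.CubicParityLoud.Negative (T3 R3 H3 L2T3)
open Summit.AnomalousDissipation.AnomalousDissipation.Theorems.QuarticGate.Negative
  (IsLevel IsBandTest polyGrad IsPolyStationary)

/-- The zeroth Fourier coefficient of a mean-zero real field vanishes:
`𝓕(complexify ∘ w)(0) = complexify (∫ w) = 0`. [folklore] -/
private theorem mFourierCoeff_complexify_zero_of_hasZeroMean {w : T3 → R3} (h0 : Torus.HasZeroMean w) :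
    UnitAddTorus.mFourierCoeff (EuclideanSpace.complexify ∘ w) 0 = 0 := by
  have h0' : ∫ x, w x = 0 := h0
  rw [Torus.mFourierCoeff_eq_integral_volume]
  simp only [neg_zero, UnitAddTorus.mFourier_zero, ContinuousMap.one_apply, one_smul,
    Function.comp_apply]
  rw [EuclideanSpace.complexify.integral_comp_comm w, h0', map_zero]

/-- Young's inequality for the real part of a Hermitian inner product:
`Re ⟪u, v⟫ ≤ b⁻¹/2 ‖u‖² + b/2 ‖v‖²` for `b > 0`. [folklore] -/
private theorem re_inner_le_young (u v : EuclideanSpace ℂ (Fin 3)) {b : ℝ} (hb : 0 < b) :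
    (inner ℂ u v).re ≤ b⁻¹ / 2 * ‖u‖ ^ 2 + b / 2 * ‖v‖ ^ 2 := by
  have h1 : (inner ℂ u v).re ≤ ‖u‖ * ‖v‖ :=
    (Complex.re_le_norm _).trans (norm_inner_le_norm u v)
  have hbc : b * b⁻¹ = 1 := mul_inv_cancel₀ hb.ne'
  have key : b⁻¹ / 2 * ‖u‖ ^ 2 + b / 2 * ‖v‖ ^ 2 - ‖u‖ * ‖v‖ = b⁻¹ / 2 * (‖u‖ - b * ‖v‖) ^ 2 := by
    have : b⁻¹ / 2 * (‖u‖ - b * ‖v‖) ^ 2 =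
        b⁻¹ / 2 * ‖u‖ ^ 2 - (b * b⁻¹) * (‖u‖ * ‖v‖) + (b * b⁻¹) * (b / 2 * ‖v‖ ^ 2) := by ring
    rw [this, hbc]; ring
  have h3 : 0 ≤ b⁻¹ / 2 * (‖u‖ - b * ‖v‖) ^ 2 := by positivity
  linarith

/-- **Spectral Poincaré–Young bound on the work of `f` against a mean-zero Galerkin state.** For
a real coefficient vector `c` on `freqBall N` whose field `u_c = realTrigPoly (freqBall N) c̄` has
zero mean, `f ∈ L²(T³)` and `b > 0`:
`∫⟪f, u_c⟫ ≤ b⁻¹/2 ∫‖f‖² + b/2 ∑ₖ |k|² ‖c k‖²` (Parseval on the finite frequency set, the zero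
mode of `c` vanishes, Young termwise, `|k|² ≥ 1` off the origin, Bessel). [folklore] -/
theorem integral_inner_realTrigPoly_le {N : ℕ}
    {c : ↥(Torus.freqBall (d := Fin 3) N) → EuclideanSpace ℂ (Fin 3)} (hc : Torus.IsRealCoeff c)
    (h0 : Torus.HasZeroMean
      (Torus.realTrigPoly (Torus.freqBall N) (Torus.coeffExt (Torus.freqBall N) c)))
    {f : T3 → R3} (hf : MemLp f 2 volume) {b : ℝ} (hb : 0 < b) :
    ∫ x, ⟪f x, Torus.realTrigPoly (Torus.freqBall N) (Torus.coeffExt (Torus.freqBall N) c) x⟫ ≤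
      b⁻¹ / 2 * (∫ x, ‖f x‖ ^ 2) +
        b / 2 * ∑ k : ↥(Torus.freqBall (d := Fin 3) N),
          Torus.freqNormSq (k : Fin 3 → ℤ) * ‖c k‖ ^ 2 := by
  have hS : ∀ k ∈ Torus.freqBall (d := Fin 3) N, -k ∈ Torus.freqBall (d := Fin 3) N :=
    Torus.neg_mem_freqBall_of_mem
  have hsymm : Torus.IsConjSymm (Torus.coeffExt (Torus.freqBall N) c) := hc.isConjSymm_coeffExt hS
  -- Parseval on the finite frequency set
  rw [Torus.integral_inner_realTrigPoly_right hS hsymm hf,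
    Torus.sum_coeffExt (fun k v =>
      (inner ℂ (UnitAddTorus.mFourierCoeff (EuclideanSpace.complexify ∘ f) k) v).re)]
  -- the zero mode of `c` vanishes
  have hc0 : ∀ k : ↥(Torus.freqBall (d := Fin 3) N), (k : Fin 3 → ℤ) = 0 → c k = 0 := by
    intro k hk
    have h1 := mFourierCoeff_complexify_zero_of_hasZeroMean h0
    rw [Torus.mFourierCoeff_realTrigPoly hS hsymm, if_pos (Torus.zero_mem_freqBall N)] at h1
    rw [← Torus.coeffExt_coe c k, hk, h1]
  -- termwise Young and `|k|² ≥ 1`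
  have hle : ∀ k : ↥(Torus.freqBall (d := Fin 3) N),
      (inner ℂ (UnitAddTorus.mFourierCoeff (EuclideanSpace.complexify ∘ f) k) (c k)).re ≤
        b⁻¹ / 2 * ‖UnitAddTorus.mFourierCoeff (EuclideanSpace.complexify ∘ f) k‖ ^ 2 +
          b / 2 * (Torus.freqNormSq (k : Fin 3 → ℤ) * ‖c k‖ ^ 2) := by
    intro k
    by_cases hk : (k : Fin 3 → ℤ) = 0
    · rw [hc0 k hk, inner_zero_right, Complex.zero_re, norm_zero]
      have h2 : 0 ≤ Torus.freqNormSq (k : Fin 3 → ℤ) := Torus.freqNormSq_nonneg _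
      positivity
    · calc (inner ℂ (UnitAddTorus.mFourierCoeff (EuclideanSpace.complexify ∘ f) k) (c k)).re
          ≤ b⁻¹ / 2 * ‖UnitAddTorus.mFourierCoeff (EuclideanSpace.complexify ∘ f) k‖ ^ 2 +
              b / 2 * ‖c k‖ ^ 2 := re_inner_le_young _ _ hb
        _ ≤ b⁻¹ / 2 * ‖UnitAddTorus.mFourierCoeff (EuclideanSpace.complexify ∘ f) k‖ ^ 2 +
              b / 2 * (Torus.freqNormSq (k : Fin 3 → ℤ) * ‖c k‖ ^ 2) := by
            gcongr
            exact le_mul_of_one_le_left (sq_nonneg _) (Torus.one_le_freqNormSq_of_ne_zero hk)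
  -- sum, then Bessel
  have hsum := Finset.sum_le_sum fun k (_ : k ∈ Finset.univ) => hle k
  rw [Finset.sum_add_distrib, ← Finset.mul_sum, ← Finset.mul_sum] at hsum
  have hbessel : ∑ k : ↥(Torus.freqBall (d := Fin 3) N),
      ‖UnitAddTorus.mFourierCoeff (EuclideanSpace.complexify ∘ f) k‖ ^ 2 ≤ ∫ x, ‖f x‖ ^ 2 :=
    calc ∑ k : ↥(Torus.freqBall (d := Fin 3) N),
          ‖UnitAddTorus.mFourierCoeff (EuclideanSpace.complexify ∘ f) k‖ ^ 2
        = ∑ k ∈ Torus.freqBall (d := Fin 3) N,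
            ‖UnitAddTorus.mFourierCoeff (EuclideanSpace.complexify ∘ f) k‖ ^ 2 :=
          Finset.sum_coe_sort (Torus.freqBall (d := Fin 3) N)
            (fun k => ‖UnitAddTorus.mFourierCoeff (EuclideanSpace.complexify ∘ f) k‖ ^ 2)
      _ ≤ ∫ x, ‖f x‖ ^ 2 :=
          sum_le_hasSum _ (fun k _ => sq_nonneg _)
            (Torus.hasSum_sq_norm_mFourierCoeff_complexify hf)
  refine hsum.trans ?_
  gcongr

/-- **S2 · `stub_pathwiseDissipation` — the energy identity bounds the time-integrated enstrophy
of a Galerkin orbit, uniformly in `N`.** For `ν > 0`, a smooth force `f`, a Galerkin mode `a` of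
order `N` whose orbit stays zero-mean, and `T ≥ 0`:
`∫₀ᵀ ‖∇S^N_t a‖² dt ≤ (‖a‖₂² + T‖f‖₂²/(4π²ν))/ν`, from the exact energy identity of the orbit
(`IsGalerkinMode.galerkinFlow_clauses`), the spectral Poincaré–Young bound
`∫⟪f, S_t a⟫ ≤ ‖f‖₂²/(8π²ν) + (ν/2)‖∇S_t a‖²` for the mean-zero Galerkin states
(`integral_inner_realTrigPoly_le`) and absorption; `0 < ν` is load-bearing
(Robinson–Rodrigo–Sadowski 2016, Thm. 4.4 Step 2, (4.6)–(4.8)). [cite: RobinsonRodrigoSadowski2016, Thm. 4.4 Step 2 (4.6)–(4.8)] -/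
theorem stub_pathwiseDissipation :
    ∀ (ν : ℝ), 0 < ν → ∀ (f : T3 → R3), Torus.IsSmooth f →
    ∀ (N : ℕ) (a : T3 → R3), IsGalerkinMode N a →
      (∀ t : ℝ, 0 ≤ t → Torus.HasZeroMean (Torus.galerkinFlow ν f N t a)) →
    ∀ T : ℝ, 0 ≤ T →
      ∫⁻ t in Set.Ioo 0 T, Torus.eGradNormSq (Torus.galerkinFlow ν f N t a) ≤
        ENNReal.ofReal ((∫ x, ‖a x‖ ^ 2 + T * (∫ x, ‖f x‖ ^ 2) / (4 * Real.pi ^ 2 * ν)) / ν) := by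
  intro ν hν f hf N a ha hzero T hT
  -- symmetry of the frequency ball, the force coefficients, the coefficient orbit
  have hS : ∀ k ∈ Torus.freqBall (d := Fin 3) N, -k ∈ Torus.freqBall (d := Fin 3) N :=
    Torus.neg_mem_freqBall_of_mem
  have hf2 : MemLp f 2 volume := hf.memLp 2
  have hg : Torus.IsRealCoeff (fourierRestrict (Torus.freqBall N) f) :=
    Torus.isRealCoeff_mFourierCoeff (hf2.integrable one_le_two)
  have hsol := isGalerkinODESolution_galerkinCoeffFlow hν.le hS hg ha.fourierRestrict_mem
  have hmem : ∀ t, galerkinCoeffFlow ν (fourierRestrict (Torus.freqBall N) f) t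
      (fourierRestrict (Torus.freqBall N) a) ∈ galerkinSubspace (Torus.freqBall N) :=
    fun t => galerkinCoeffFlow_mem ha.fourierRestrict_mem t
  -- the dissipation as a real function of time
  obtain ⟨E, hE⟩ : ∃ E : ℝ → ℝ, E = fun t => 4 * Real.pi ^ 2 *
      ∑ k : ↥(Torus.freqBall (d := Fin 3) N), Torus.freqNormSq (k : Fin 3 → ℤ) *
        ‖galerkinCoeffFlow ν (fourierRestrict (Torus.freqBall N) f) t
          (fourierRestrict (Torus.freqBall N) a) k‖ ^ 2 := ⟨_, rfl⟩
  have hEt : ∀ t, E t = 4 * Real.pi ^ 2 *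
      ∑ k : ↥(Torus.freqBall (d := Fin 3) N), Torus.freqNormSq (k : Fin 3 → ℤ) *
        ‖galerkinCoeffFlow ν (fourierRestrict (Torus.freqBall N) f) t
          (fourierRestrict (Torus.freqBall N) a) k‖ ^ 2 := fun t => by rw [hE]
  have hZ : ∀ t, Torus.eGradNormSq (Torus.galerkinFlow ν f N t a) = ENNReal.ofReal (E t) := by
    intro t
    rw [ha.galerkinFlow_eq, hEt]
    exact eGradNormSq_coeffExt hS (hmem t).1
  have hE0 : ∀ t, 0 ≤ E t := fun t => by
    rw [hEt]
    exact mul_nonneg (by positivity) (Finset.sum_nonneg fun k _ =>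
      mul_nonneg (Torus.freqNormSq_nonneg _) (sq_nonneg _))
  have hEcont : ContinuousOn E (Icc 0 T) := by
    have hα : ContinuousOn (fun t => galerkinCoeffFlow ν (fourierRestrict (Torus.freqBall N) f) t
        (fourierRestrict (Torus.freqBall N) a)) (Icc 0 T) :=
      hsol.continuousOn.mono Icc_subset_Ici_self
    rw [hE]
    refine continuousOn_const.mul (continuousOn_finsetSum _ fun k _ => ?_)
    exact continuousOn_const.mul (((continuous_apply k).comp_continuousOn hα).norm.pow 2)
  have hEint : IntervalIntegrable E volume 0 T := hEcont.intervalIntegrable_of_Icc hT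
  -- the lintegral is `ofReal` of an honest integral
  have hint : IntegrableOn E (Ioo 0 T) volume :=
    (hEcont.integrableOn_compact isCompact_Icc).mono_set Ioo_subset_Icc_self
  have hI0 : 0 ≤ ∫ t in Ioo 0 T, E t := integral_nonneg fun t => hE0 t
  have hL : ∫⁻ t in Ioo 0 T, Torus.eGradNormSq (Torus.galerkinFlow ν f N t a) =
      ENNReal.ofReal (∫ t in Ioo 0 T, E t) := by
    simp_rw [hZ]
    exact (ofReal_integral_eq_lintegral_ofReal hint (ae_of_all _ hE0)).symm
  -- the exact energy identity from `0` to `T`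
  obtain ⟨-, -, -, -, henergy⟩ := ha.galerkinFlow_clauses (ν := ν) hν.le hf2
  have hen := henergy 0 T le_rfl hT
  rw [Torus.galerkinFlow_zero, hL, ENNReal.toReal_ofReal hI0] at hen
  -- the work bound, pointwise in time
  have hwork : ∀ τ : ℝ, 0 ≤ τ → ∫ x, ⟪f x, Torus.galerkinFlow ν f N τ a x⟫ ≤
      (4 * Real.pi ^ 2 * ν)⁻¹ / 2 * (∫ x, ‖f x‖ ^ 2) + ν / 2 * E τ := by
    intro τ hτ
    have hb : 0 < 4 * Real.pi ^ 2 * ν := by positivity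
    have hz : Torus.HasZeroMean (Torus.realTrigPoly (Torus.freqBall N) (Torus.coeffExt
        (Torus.freqBall N) (galerkinCoeffFlow ν (fourierRestrict (Torus.freqBall N) f) τ
          (fourierRestrict (Torus.freqBall N) a)))) := by
      rw [← ha.galerkinFlow_eq]; exact hzero τ hτ
    have h := integral_inner_realTrigPoly_le (hmem τ).1 hz hf2 hb
    rw [← ha.galerkinFlow_eq] at h
    refine h.trans (le_of_eq ?_)
    rw [hEt]
    ring
  -- integrate the work bound over `[0, T]`
  have hW : ∫ τ in (0 : ℝ)..T, ∫ x, ⟪f x, Torus.galerkinFlow ν f N τ a x⟫ ≤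
      (4 * Real.pi ^ 2 * ν)⁻¹ / 2 * (∫ x, ‖f x‖ ^ 2) * T + ν / 2 * ∫ t in Ioo 0 T, E t := by
    have hrhs_int : IntervalIntegrable
        (fun τ => (4 * Real.pi ^ 2 * ν)⁻¹ / 2 * (∫ x, ‖f x‖ ^ 2) + ν / 2 * E τ) volume 0 T :=
      (continuousOn_const.add (continuousOn_const.mul hEcont)).intervalIntegrable_of_Icc hT
    have hrhs : ∫ τ in (0 : ℝ)..T, ((4 * Real.pi ^ 2 * ν)⁻¹ / 2 * (∫ x, ‖f x‖ ^ 2) + ν / 2 * E τ) =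
        (4 * Real.pi ^ 2 * ν)⁻¹ / 2 * (∫ x, ‖f x‖ ^ 2) * T + ν / 2 * ∫ t in Ioo 0 T, E t := by
      rw [intervalIntegral.integral_add intervalIntegrable_const (hEint.const_mul _),
        intervalIntegral.integral_const, intervalIntegral.integral_const_mul,
        intervalIntegral.integral_of_le hT, integral_Ioc_eq_integral_Ioo, smul_eq_mul, sub_zero]
      ring
    by_cases hWi : IntervalIntegrable (fun τ => ∫ x, ⟪f x, Torus.galerkinFlow ν f N τ a x⟫)
        volume 0 T
    · rw [← hrhs]
      exact intervalIntegral.integral_mono_on hT hWi hrhs_int fun τ hτ => hwork τ hτ.1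
    · rw [intervalIntegral.integral_undef hWi]
      have h1 : 0 ≤ (4 * Real.pi ^ 2 * ν)⁻¹ / 2 * (∫ x, ‖f x‖ ^ 2) * T :=
        mul_nonneg (mul_nonneg (by positivity) (integral_nonneg fun x => sq_nonneg _)) hT
      have h2 : 0 ≤ ν / 2 * ∫ t in Ioo 0 T, E t := mul_nonneg (by positivity) hI0
      linarith
  -- absorb
  have hKT : 0 ≤ Torus.kineticEnergy (Torus.galerkinFlow ν f N T a) := Torus.kineticEnergy_nonneg _
  have hKa : Torus.kineticEnergy a = 2⁻¹ * ∫ x, ‖a x‖ ^ 2 := rfl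
  have hid : 2 * ((4 * Real.pi ^ 2 * ν)⁻¹ / 2 * (∫ x, ‖f x‖ ^ 2) * T) =
      T * (∫ x, ‖f x‖ ^ 2) / (4 * Real.pi ^ 2 * ν) := by
    field_simp
  have hI : ∫ t in Ioo 0 T, E t ≤
      ((∫ x, ‖a x‖ ^ 2) + T * (∫ x, ‖f x‖ ^ 2) / (4 * Real.pi ^ 2 * ν)) / ν := by
    rw [le_div_iff₀ hν]
    nlinarith
  -- the mean of a constant on the unit torus
  have hai : Integrable (fun x => ‖a x‖ ^ 2) volume :=
    (ha.isSmooth.memLp 2).integrable_norm_pow two_ne_zero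
  have hconst : ∫ x, ‖a x‖ ^ 2 + T * (∫ x, ‖f x‖ ^ 2) / (4 * Real.pi ^ 2 * ν) =
      (∫ x, ‖a x‖ ^ 2) + T * (∫ x, ‖f x‖ ^ 2) / (4 * Real.pi ^ 2 * ν) := by
    rw [integral_add hai (integrable_const _), integral_const, probReal_univ, one_smul]
  rw [hL, hconst]
  exact ENNReal.ofReal_le_ofReal hI

end Summit.AnomalousDissipation.AnomalousDissipation.Theorems.MomentParityResolvedDissipation.PathwiseDissipation

end
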